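import Summits.ValiantsHypothesis.ValiantsHypothesis.Theorems.KPlusLogSqLawTridiagonalRealStatic

/-!
# Route «KPlusLogSqLaw», crux `WeakLifting` (stmt-ValiantsHypothesis-19561) — REAL side of the tridiagonal sector:
# a STATIC DEFINITE symmetric tridiagonal `6 × 6` monomial matrix with SEVEN positive determinant zeros («Z ≤ m» fails already at `m = 6`)

HONEST FRAMING.  Helper theorems (`--supports stmt-ValiantsHypothesis-19561 --as helper`) about the REAL side of the witness-plan stub
`stub_tridiagonalSectorB` (`Cruxes/WeakLifting/Lines/birth.lean`), in the typed currency of the desk's α target of record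
`staticTridiagonal_definite_posRoots_le` (lead R2102/R2114).  Seat val-sym-lift-p1 (g11), cell `pub-symmetroid`, 2026-08-27.  Companion of
`…TridiagonalRealStaticSevenEight` (size `7`, eight zeros) and `…TridiagonalRealStaticNineEleven` (size `9`, eleven zeros).  One explicit matrix
and its exact root certificate; NOTHING here is an upper bound; nothing bears on `WeakLifting` / `TropicalB` (stmt-19771) in their windows, on
Conjecture B, on the Door-A registers, on `MatrixDescartes` (stmt-ValiantsHypothesis-18050) or on VP ≠ VNP.  FIXED-FORMAT statement.

THE WITNESS (two-sided hierarchical schedule, seat tools `twosided.py`).  Path on `6` vertices; diagonal entries `(2¹²⁰X⁵⁹, X, 4, X, 1, 1)`,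
off-diagonal entries `(1, 2, X, 2X, X⁵)`; edge weights `W = (2⁻¹²⁰x⁻⁶⁰ | x⁻¹, x/4, 4x, x¹⁰)`: ONE fast DECREASING edge prepended on the LEFT of
the `m = 5` boost block of `…TridiagonalRealStaticFive` (five zeros on four edges), switching off at `t = ln x ≈ −1.386`, inside the gap between the
zero of `I(edges 2..4)` at `t ≈ −1.447` and the zero of `I(edges 1..4)` at `t ≈ −1.365`: while the left edge dominates, the slow factor is
`I(2..4)` (one zero collected), the switch itself fires, and afterwards the slow factor is the full boost block (five zeros): `1 + 1 + 5 = 7`.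
The kernel row of record at `m = 6` was `6` (`…StaticTridiagonalDefiniteSix`, lift-p2 g8).

WHAT IS PROVED.  Through the continuant normal form (`StaticTridiagonalReal.det_ctPath`, lift-p3 g8) the determinant has an explicit closed
form (`eval_det_six7`) which alternates in sign at `x = 1/8, 31/128, 255/1024, 1/2, 5/4, 3/2, 2, 3` (`seven_le_card_posRoots_six`); hence `≥ 7` distinct positive
zeros.  Corollaries in the typed currency: `exists_static_definite_tridiagonal_six_seven` and `not_posRoots_le_size_static_tridiagonal_six`
(it is FALSE that every static definite symmetric tridiagonal `6 × 6` monomial matrix has at most `6` distinct positive determinant zeros).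
[data of this seat] explicit matrix; [folklore] continuants / IVT.
-/

-- `Summit.ValiantsHypothesis.ValiantsHypothesis.…` repeats a component by the D-0017 layout (single-conjunct summit); the name is mandated.
set_option linter.dupNamespace false

namespace Summit.ValiantsHypothesis.ValiantsHypothesis.Theorems.KPlusLogSqLaw.StaticTridiagonalRealExcess

open scoped BigOperators Matrix
open Polynomial
open Summit.ValiantsHypothesis.ValiantsHypothesis.Theorems.ValuativeFlip (ctK ctPath ctPath_apply ctK_zero ctK_one ctK_add_two)
open Summit.ValiantsHypothesis.ValiantsHypothesis.Theorems.KPlusLogSqLaw.StaticTridiagonalReal (det_ctPath)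
open Summit.ValiantsHypothesis.ValiantsHypothesis.Theorems.SymmetroidDescartes (le_card_posRoots_of_alternating)

set_option maxHeartbeats 4000000 in
set_option maxRecDepth 200000 in
set_option exponentiation.threshold 10000 in
/-- Closed form of the determinant of the `6 × 6` witness through the continuant normal form `det_ctPath`. [data of this seat] -/
theorem eval_det_six7 (t : ℝ) :
    ((ctPath
      (fun t : ℕ => if t = 0 then (C (1329227995784915872903807060280344576 : ℝ) * X ^ 59 : ℝ[X]) else if t = 1 then (X : ℝ[X]) else if t = 2 then (C (4 : ℝ) : ℝ[X]) else if t = 3 then (X : ℝ[X]) else if t = 4 then (1 : ℝ[X]) else if t = 5 then (1 : ℝ[X]) else (0 : ℝ[X]))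
      (fun t : ℕ => if t = 0 then (1 : ℝ[X]) else if t = 1 then (C (2 : ℝ) : ℝ[X]) else if t = 2 then (X : ℝ[X]) else if t = 3 then (C (2 : ℝ) * X : ℝ[X]) else if t = 4 then (X ^ 5 : ℝ[X]) else (0 : ℝ[X]))
      (fun t : ℕ => if t = 0 then (0 : ℝ[X]) else if t = 1 then (1 : ℝ[X]) else if t = 2 then (C (2 : ℝ) : ℝ[X]) else if t = 3 then (X : ℝ[X]) else if t = 4 then (C (2 : ℝ) * X : ℝ[X]) else if t = 5 then (X ^ 5 : ℝ[X]) else (0 : ℝ[X])) 6).det).eval t =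
      (1329227995784915872903807060280344576 : ℝ) * t ^ 72 +
      (-5316911983139663491615228241121378304 : ℝ) * t ^ 71 +
      (5316911983139663491615228241121378304 : ℝ) * t ^ 70 +
      (-22596875928343569839364720024765857792 : ℝ) * t ^ 62 +
      (26584559915698317458076141205606891520 : ℝ) * t ^ 61 +
      (-5316911983139663491615228241121378304 : ℝ) * t ^ 60 +
      (-1 : ℝ) * t ^ 12 +
      (4 : ℝ) * t ^ 11 +
      (17 : ℝ) * t ^ 2 +
      (-4 : ℝ) * t ^ 1 := by
  rw [det_ctPath]
  simp only [ctK_add_two, ctK_one, ctK_zero]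
  norm_num [eval_add, eval_sub, eval_mul, eval_neg, eval_pow, eval_C, eval_X]
  ring

set_option maxHeartbeats 4000000 in
set_option maxRecDepth 200000 in
set_option exponentiation.threshold 10000 in
/-- **At least seven distinct positive zeros on five edges (size six)**: the determinant of the `6 × 6` witness alternates in sign at
`x = 1/8, 31/128, 255/1024, 1/2, 5/4, 3/2, 2, 3`. [data of this seat] -/
theorem seven_le_card_posRoots_six :
    7 ≤ (((ctPath
      (fun t : ℕ => if t = 0 then (C (1329227995784915872903807060280344576 : ℝ) * X ^ 59 : ℝ[X]) else if t = 1 then (X : ℝ[X]) else if t = 2 then (C (4 : ℝ) : ℝ[X]) else if t = 3 then (X : ℝ[X]) else if t = 4 then (1 : ℝ[X]) else if t = 5 then (1 : ℝ[X]) else (0 : ℝ[X]))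
      (fun t : ℕ => if t = 0 then (1 : ℝ[X]) else if t = 1 then (C (2 : ℝ) : ℝ[X]) else if t = 2 then (X : ℝ[X]) else if t = 3 then (C (2 : ℝ) * X : ℝ[X]) else if t = 4 then (X ^ 5 : ℝ[X]) else (0 : ℝ[X]))
      (fun t : ℕ => if t = 0 then (0 : ℝ[X]) else if t = 1 then (1 : ℝ[X]) else if t = 2 then (C (2 : ℝ) : ℝ[X]) else if t = 3 then (X : ℝ[X]) else if t = 4 then (C (2 : ℝ) * X : ℝ[X]) else if t = 5 then (X ^ 5 : ℝ[X]) else (0 : ℝ[X])) 6).det).roots.toFinset.filter (fun t => 0 < t)).card := by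
  refine le_card_posRoots_of_alternating _ 7
    (![1/8, 31/128, 255/1024, 1/2, 5/4, 3/2, 2, 3] : Fin 8 → ℝ) ?_ ?_ ?_
  · refine Fin.strictMono_iff_lt_succ.2 fun j => ?_
    fin_cases j <;> simp only [Fin.castSucc_mk, Fin.succ_mk] <;> norm_num
  · intro j; fin_cases j <;> norm_num
  · intro j; fin_cases j <;> simp only [eval_det_six7, Fin.castSucc_mk, Fin.succ_mk] <;> norm_num

set_option maxHeartbeats 4000000 in
/-- The `6 × 6` witness in the desk's typed currency (R2102/R2114): the monomial matrix `of (fun i j => C (c i j) * X ^ (e i j))` with the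
tables below IS the path matrix of `eval_det_six7`. [data of this seat] -/
theorem of_eq_ctPath_six7 :
    (Matrix.of fun i j : Fin 6 =>
        C ((((fun i j : Fin 6 => (if (j : ℕ) = i then (fun t : ℕ => if t = 0 then 1329227995784915872903807060280344576 else if t = 1 then 1 else if t = 2 then 4 else if t = 3 then 1 else if t = 4 then 1 else if t = 5 then 1 else 0) i else if (j : ℕ) = i + 1 then (fun t : ℕ => if t = 0 then 1 else if t = 1 then 2 else if t = 2 then 1 else if t = 3 then 2 else if t = 4 then 1 else 0) i else if (i : ℕ) = j + 1 then (fun t : ℕ => if t = 0 then 1 else if t = 1 then 2 else if t = 2 then 1 else if t = 3 then 2 else if t = 4 then 1 else 0) j else 0 : ℕ)) i j : ℕ) : ℝ)) * (X : ℝ[X]) ^ ((fun i j : Fin 6 => (if (j : ℕ) = i then (fun t : ℕ => if t = 0 then 59 else if t = 1 then 1 else if t = 2 then 0 else if t = 3 then 1 else if t = 4 then 0 else if t = 5 then 0 else 0) i else if (j : ℕ) = i + 1 then (fun t : ℕ => if t = 0 then 0 else if t = 1 then 0 else if t = 2 then 1 else if t = 3 then 1 else if t = 4 then 5 else 0) i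 else if (i : ℕ) = j + 1 then (fun t : ℕ => if t = 0 then 0 else if t = 1 then 0 else if t = 2 then 1 else if t = 3 then 1 else if t = 4 then 5 else 0) j else 0 : ℕ)) i j)) =
      (ctPath
      (fun t : ℕ => if t = 0 then (C (1329227995784915872903807060280344576 : ℝ) * X ^ 59 : ℝ[X]) else if t = 1 then (X : ℝ[X]) else if t = 2 then (C (4 : ℝ) : ℝ[X]) else if t = 3 then (X : ℝ[X]) else if t = 4 then (1 : ℝ[X]) else if t = 5 then (1 : ℝ[X]) else (0 : ℝ[X]))
      (fun t : ℕ => if t = 0 then (1 : ℝ[X]) else if t = 1 then (C (2 : ℝ) : ℝ[X]) else if t = 2 then (X : ℝ[X]) else if t = 3 then (C (2 : ℝ) * X : ℝ[X]) else if t = 4 then (X ^ 5 : ℝ[X]) else (0 : ℝ[X]))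
      (fun t : ℕ => if t = 0 then (0 : ℝ[X]) else if t = 1 then (1 : ℝ[X]) else if t = 2 then (C (2 : ℝ) : ℝ[X]) else if t = 3 then (X : ℝ[X]) else if t = 4 then (C (2 : ℝ) * X : ℝ[X]) else if t = 5 then (X ^ 5 : ℝ[X]) else (0 : ℝ[X])) 6) := by
  ext i j
  simp only [Matrix.of_apply, ctPath_apply]
  have hi : (i : ℕ) < 6 := i.isLt
  have hj : (j : ℕ) < 6 := j.isLt
  by_cases h1 : (j : ℕ) = i
  · simp only [h1, if_true]
    generalize (i : ℕ) = t at hi ⊢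
    interval_cases t <;> simp
  · rw [if_neg h1, if_neg h1, if_neg h1]
    by_cases h2 : (j : ℕ) = i + 1
    · simp only [h2, if_true]
      have hi' : (i : ℕ) < 5 := by omega
      generalize (i : ℕ) = t at hi' ⊢
      interval_cases t <;> simp
    · rw [if_neg h2, if_neg h2, if_neg h2]
      by_cases h3 : (i : ℕ) = j + 1
      · simp only [h3, if_true]
        have hj' : (j : ℕ) < 5 := by omega
        generalize (j : ℕ) = t at hj' ⊢
        interval_cases t <;> simp
      · rw [if_neg h3, if_neg h3, if_neg h3]
        simp

/-- **A STATIC DEFINITE SYMMETRIC TRIDIAGONAL `6 × 6` MONOMIAL MATRIX WITH SEVEN POSITIVE DETERMINANT ZEROS** — one MORE than its size —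
in the typed currency of the desk's α target (R2102/R2114): any linear law `B` for the sub-sector has `B 6 ≥ 7`. [data of this seat] -/
theorem exists_static_definite_tridiagonal_six_seven :
    ∃ (c : Fin 6 → Fin 6 → ℝ) (e : Fin 6 → Fin 6 → ℕ),
      (∀ i j, c i j = c j i) ∧ (∀ i j, e i j = e j i) ∧
      (∀ i j : Fin 6, (i : ℕ) + 1 < j ∨ (j : ℕ) + 1 < i → c i j = 0) ∧ (∀ i, 0 < c i i) ∧
      7 ≤ ((Matrix.det (Matrix.of fun i j => C (c i j) * (X : ℝ[X]) ^ (e i j))).roots.toFinset.filter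
        (fun t => 0 < t)).card := by
  refine ⟨fun i j => ((((fun i j : Fin 6 => (if (j : ℕ) = i then (fun t : ℕ => if t = 0 then 1329227995784915872903807060280344576 else if t = 1 then 1 else if t = 2 then 4 else if t = 3 then 1 else if t = 4 then 1 else if t = 5 then 1 else 0) i else if (j : ℕ) = i + 1 then (fun t : ℕ => if t = 0 then 1 else if t = 1 then 2 else if t = 2 then 1 else if t = 3 then 2 else if t = 4 then 1 else 0) i else if (i : ℕ) = j + 1 then (fun t : ℕ => if t = 0 then 1 else if t = 1 then 2 else if t = 2 then 1 else if t = 3 then 2 else if t = 4 then 1 else 0) j else 0 : ℕ)) i j : ℕ) : ℝ)), (fun i j : Fin 6 => (if (j : ℕ) = i then (fun t : ℕ => if t = 0 then 59 else if t = 1 then 1 else if t = 2 then 0 else if t = 3 then 1 else if t = 4 then 0 else if t = 5 then 0 else 0) i else if (j : ℕ) = i + 1 then (fun t : ℕ => if t = 0 then 0 else if t = 1 then 0 else if t = 2 then 1 else if t = 3 then 1 else if t = 4 then 5 else 0) i else if (i : ℕ) = j + 1 then (fun t : ℕ => if t = 0 then 0 else if t = 1 then 0 else if t = 2 then 1 else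 if t = 3 then 1 else if t = 4 then 5 else 0) j else 0 : ℕ)), ?_, ?_, ?_, ?_, ?_⟩
  · have h : ∀ i j : Fin 6, (fun i j : Fin 6 => (if (j : ℕ) = i then (fun t : ℕ => if t = 0 then 1329227995784915872903807060280344576 else if t = 1 then 1 else if t = 2 then 4 else if t = 3 then 1 else if t = 4 then 1 else if t = 5 then 1 else 0) i else if (j : ℕ) = i + 1 then (fun t : ℕ => if t = 0 then 1 else if t = 1 then 2 else if t = 2 then 1 else if t = 3 then 2 else if t = 4 then 1 else 0) i else if (i : ℕ) = j + 1 then (fun t : ℕ => if t = 0 then 1 else if t = 1 then 2 else if t = 2 then 1 else if t = 3 then 2 else if t = 4 then 1 else 0) j else 0 : ℕ)) i j = (fun i j : Fin 6 => (if (j : ℕ) = i then (fun t : ℕ => if t = 0 then 1329227995784915872903807060280344576 else if t = 1 then 1 else if t = 2 then 4 else if t = 3 then 1 else if t = 4 then 1 else if t = 5 then 1 else 0) i else if (j : ℕ) = i + 1 then (fun t : ℕ => if t = 0 then 1 else if t = 1 then 2 else if t = 2 then 1 else if t = 3 then 2 else if t = 4 then 1 else 0) i else if (i : ℕ) = j +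 1 then (fun t : ℕ => if t = 0 then 1 else if t = 1 then 2 else if t = 2 then 1 else if t = 3 then 2 else if t = 4 then 1 else 0) j else 0 : ℕ)) j i := by decide
    intro i j
    exact congrArg (Nat.cast (R := ℝ)) (h i j)
  · decide
  · have h : ∀ i j : Fin 6, (i : ℕ) + 1 < j ∨ (j : ℕ) + 1 < i → (fun i j : Fin 6 => (if (j : ℕ) = i then (fun t : ℕ => if t = 0 then 1329227995784915872903807060280344576 else if t = 1 then 1 else if t = 2 then 4 else if t = 3 then 1 else if t = 4 then 1 else if t = 5 then 1 else 0) i else if (j : ℕ) = i + 1 then (fun t : ℕ => if t = 0 then 1 else if t = 1 then 2 else if t = 2 then 1 else if t = 3 then 2 else if t = 4 then 1 else 0) i else if (i : ℕ) = j + 1 then (fun t : ℕ => if t = 0 then 1 else if t = 1 then 2 else if t = 2 then 1 else if t = 3 then 2 else if t = 4 then 1 else 0) j else 0 : ℕ)) i j = 0 := by decide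
    intro i j hij
    have h' := h i j hij
    beta_reduce at h' ⊢
    rw [h', Nat.cast_zero]
  · have h : ∀ i : Fin 6, 0 < (fun i j : Fin 6 => (if (j : ℕ) = i then (fun t : ℕ => if t = 0 then 1329227995784915872903807060280344576 else if t = 1 then 1 else if t = 2 then 4 else if t = 3 then 1 else if t = 4 then 1 else if t = 5 then 1 else 0) i else if (j : ℕ) = i + 1 then (fun t : ℕ => if t = 0 then 1 else if t = 1 then 2 else if t = 2 then 1 else if t = 3 then 2 else if t = 4 then 1 else 0) i else if (i : ℕ) = j + 1 then (fun t : ℕ => if t = 0 then 1 else if t = 1 then 2 else if t = 2 then 1 else if t = 3 then 2 else if t = 4 then 1 else 0) j else 0 : ℕ)) i i := by decide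
    intro i
    have h' := h i
    beta_reduce at h' ⊢
    exact_mod_cast h'
  · rw [of_eq_ctPath_six7]
    exact seven_le_card_posRoots_six

/-- **«Z ≤ m» FAILS AT `m = 6`**: it is false that every STATIC DEFINITE symmetric tridiagonal `6 × 6` monomial matrix has at most `6` distinct
positive determinant zeros. [corollary] -/
theorem not_posRoots_le_size_static_tridiagonal_six :
    ¬ (∀ (c : Fin 6 → Fin 6 → ℝ) (e : Fin 6 → Fin 6 → ℕ), (∀ i j, c i j = c j i) → (∀ i j, e i j = e j i) →
        (∀ i j : Fin 6, (i : ℕ) + 1 < j ∨ (j : ℕ) + 1 < i → c i j = 0) → (∀ i, 0 < c i i) →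
        ((Matrix.det (Matrix.of fun i j => C (c i j) * (X : ℝ[X]) ^ (e i j))).roots.toFinset.filter
          (fun t => 0 < t)).card ≤ 6) := by
  intro h
  obtain ⟨c, e, hc, he, htri, hpos, h7⟩ := exists_static_definite_tridiagonal_six_seven
  have := h c e hc he htri hpos
  omega

end Summit.ValiantsHypothesis.ValiantsHypothesis.Theorems.KPlusLogSqLaw.StaticTridiagonalRealExcess
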